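import Mathlib
import Summits.Ventures.PercRepro2.ThreeTypedAbstract

/-!
# Three typed edges, shards 10/11 (blind cell PercRepro2, night-3, 2026-08-24)

`decide +kernel` of the shards `shard a1 … a5 = true` of `allOk3` for the canonical prefixes listed
below (4 shards, 41708 labellings of the eleven points in this file).
-/

set_option Elab.async false

namespace Summit.Ventures.PercRepro2

open UnionCluster

namespace CovForm

namespace TwoTyped

open OneTyped

set_option maxHeartbeats 0 in
/-- Shard `(1, 2, 3, 4, 1)` (10427 labellings). -/
theorem sh_1_2_3_4_1 : shard 1 2 3 4 1 = true := by
  decide +kernel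

set_option maxHeartbeats 0 in
/-- Shard `(1, 2, 3, 4, 2)` (10427 labellings). -/
theorem sh_1_2_3_4_2 : shard 1 2 3 4 2 = true := by
  decide +kernel

set_option maxHeartbeats 0 in
/-- Shard `(1, 2, 3, 4, 3)` (10427 labellings). -/
theorem sh_1_2_3_4_3 : shard 1 2 3 4 3 = true := by
  decide +kernel

set_option maxHeartbeats 0 in
/-- Shard `(1, 2, 3, 4, 4)` (10427 labellings). -/
theorem sh_1_2_3_4_4 : shard 1 2 3 4 4 = true := by
  decide +kernel

end TwoTyped

end CovForm

end Summit.Ventures.PercRepro2
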